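import Summits.BirchSwinnertonDyer.BirchSwinnertonDyer.Theorems.GenusKolyvaginAtTwoGenusDeepSupplyAtTwoNegDiscNarrowKFourCellHalvingDescentKFourNeg
import Summits.BirchSwinnertonDyer.BirchSwinnertonDyer.Theses.GenusKolyvaginAtTwo
import HarnessLib

/-!
# Route `GenusKolyvaginAtTwo`: CLOSER of the depth-one support item `K4NegDepthOneOnCut` (stmt-BirchSwinnertonDyer-33814)

Seat `bsd-line-gk2-p3` g31 (PROVER seat 3/3, cell `bsd-f1-sign2`), `--workitem stmt-BirchSwinnertonDyer-33814`.  THEOREM ONLY (no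
definition, no named fact, no `sorry`); standard axioms.

The item (filed by the route pen bsd-idea-1 g26, director-bsd (546)/(549)(B)/(586)(A), text = LEAD gk2-p1 g24 kit
`Cruxes/GenusDeepSupplyAtTwoNegDiscNarrow/Lines/depth_one_items.lean`, signatures byte-identical) is K4Neg (crux 23491 / stmt-BirchSwinnertonDyer-31526) restricted to its
DEPTH-ONE sub-cell (`M₀ = 1`) on the multiplicative cut (an odd prime `v ∣ N_E` of multiplicative reduction), with Q2
`KolyvaginRelationAtTwo` (stmt-BirchSwinnertonDyer-24880) as antecedent.  It was filed by `workitem add --kind statement`, so it has NO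
decl in the route file; the theorem below therefore carries the item's signature VERBATIM as its type (the gate's accept-time probe matches
the term), with `KolyvaginRelationAtTwo` the route decl `Summit.BirchSwinnertonDyer.BirchSwinnertonDyer.Theses.GenusKolyvaginAtTwo.KolyvaginRelationAtTwo`.
The proof is the eta-expansion of gk2-p5 g36's landed theorem
`GenusExact.PlusDescent.kFourNeg_conclusion_of_depth_one_of_hasMultiplicativeReductionAt` (p771204) — exactly the LEAD kit's
closer `k4NegDepthOneOnCut_holds` (rc 0 there).  No new mathematics.

HONEST STATUS: this closes a depth-one SUPPORT item only (count-neutral bookkeeping of a landed kernel theorem, CONDITIONAL on Q2 as displayed);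
**BSD is NOT proved by this; K4Neg (31526) at depth ≥ 2, the parent supply crux, Q2 and the route's leaf stay OPEN.**

References: [GrossLMS1991] §4; [McCallumLMS1991] §5; [Kolyvagin1991MathAnn]; [MazurRubin2010] Cor. 3.4 (i).
-/

set_option autoImplicit false
set_option linter.dupNamespace false -- `Summit.<P>.<Sub>` repeats `BirchSwinnertonDyer` (D-0017)

noncomputable section

namespace Summit.BirchSwinnertonDyer.BirchSwinnertonDyer.Theorems

open Summit.BirchSwinnertonDyer.BirchSwinnertonDyer.Theses.GenusKolyvaginAtTwo (KolyvaginRelationAtTwo)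

/-- **CLOSER of item `K4NegDepthOneOnCut` (stmt-BirchSwinnertonDyer-33814)** — the item's signature VERBATIM: K4Neg (crux 23491 / stmt-BirchSwinnertonDyer-31526) on its depth-one sub-cell (`M₀ = 1`) on
the multiplicative cut, Q2 `KolyvaginRelationAtTwo` as antecedent.  Eta-expansion of
`GenusExact.PlusDescent.kFourNeg_conclusion_of_depth_one_of_hasMultiplicativeReductionAt` (gk2-p5 g36, p771204).  CONDITIONAL on Q2 (displayed); BSD is NOT
proved by this; K4Neg (31526) at depth ≥ 2 stays open. [cite: GrossLMS1991, §4] [cite: McCallumLMS1991, §5] -/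
theorem k4NegDepthOneOnCut_proof :
    KolyvaginRelationAtTwo → ∀ (W : WeierstrassCurve ℚ) [W.IsElliptic] [W.IsGloballyMinimal] [NeZero (W.conductorNorm ℤ)], ¬ W.HasCM → W.analyticRank = 0 → (∀ n : ℕ, 0 < n → W.HasSurjectiveModNGaloisRep ((2 : ℤ) ^ n)) → Odd W.tamagawaProduct → W.Δ < 0 → Nat.card (W.selmerGroup 2) = 4 → ∀ (v : IsDedekindDomain.HeightOneSpectrum (NumberField.RingOfIntegers ℚ)), ((2 : ℕ) : NumberField.RingOfIntegers ℚ) ∉ v.asIdeal → ((W.conductorNorm ℤ : ℕ) : NumberField.RingOfIntegers ℚ) ∈ v.asIdeal → W.HasMultiplicativeReductionAt v → ∀ (K : Type) [Field K] [NumberField K], Literature.NumberTheory.EllipticCurves.IsImaginaryQuadratic K → Odd (NumberField.discr K) → NumberField.discr K ≠ -3 → Literature.NumberTheory.EllipticCurves.SatisfiesHeegnerHypothesis (W.conductorNorm ℤ) K → ¬ IsSquare ((NumberField.discr K : ℚ) * -|W.Δ|) → ¬ IsSquare ((NumberField.discr K : ℚ) * (-(2 * |W.Δ|))) → ∀ (ℓ₀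 : ℕ), ℓ₀.Prime → NumberField.discr K = -(ℓ₀ : ℤ) → ((Ideal.span {(2 : ℤ)}).primesOver (NumberField.RingOfIntegers K)).ncard = 2 → ∀ (Dt : Literature.NumberTheory.EllipticCurves.ModularForms.ModularParametrizationData W (W.conductorNorm ℤ)), (∀ z ∈ Dt.L.lattice, ∃ w ∈ Literature.NumberTheory.EllipticCurves.ModularForms.periodLattice Dt.f, z = (Dt.c : ℂ) * w) → Odd Dt.c → ∀ (β : ℤ) (ι : K →+* ℂ) (d₁ : Literature.NumberTheory.EllipticCurves.KolyvaginHeegnerData Dt β ι 1), ¬ IsOfFinAddOrder d₁.derivedPoint → ∀ (M₀ : ℕ), (∃ Q : (W.baseChange (Literature.NumberTheory.EllipticCurves.ringClassField K ι 1)).toAffine.Point, ((2 ^ M₀ : ℕ) : ℤ) • Q = d₁.derivedPoint) → (¬ ∃ Q : (W.baseChange (Literature.NumberTheory.EllipticCurves.ringClassField K ι 1)).toAffine.Point, ((2 ^ (M₀ + 1) : ℕ) : ℤ) • Q = d₁.derivedPoint) → M₀ = 1 → ∀ (Wd : WeierstrassCurve ℚ) [Wd.IsElliptic] [Wd.IsGloballyMinimal],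 (∃ C : WeierstrassCurve.VariableChange ℚ, C • W.quadraticTwist (NumberField.discr K : ℚ) = Wd) → Wd.analyticRank = 1 → Nat.card (Wd.selmerGroup 2) = 2 → padicValNat 2 Wd.tamagawaProduct ≤ 1 → ∃ (n : ℕ) (d : Literature.NumberTheory.EllipticCurves.KolyvaginHeegnerData Dt β ι n), Squarefree n ∧ (∀ ℓ ∈ n.primeFactors, Literature.NumberTheory.EllipticCurves.Zhang2014.IsKolyvaginPrime (W.conductorNorm ℤ) W K 2 ℓ ∧ 2 ≤ Literature.NumberTheory.EllipticCurves.Zhang2014.kolyvaginIndex W 2 ℓ ∧ Literature.NumberTheory.EllipticCurves.FrobEqFrobInfty W K 2 ℓ) ∧ ¬ ∃ Q : (W.baseChange (Literature.NumberTheory.EllipticCurves.ringClassField K ι n)).toAffine.Point, (2 : ℤ) • Q = d.derivedPoint :=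
  fun hQ2 W _ _ _ hcm hr0 hρ hT hneg h4 v h2v hNv hmult K _ _ hIQ hodd h3 hHe hsq1 hsq2 ℓ₀ hℓ₀ hdK h2K Dt hopt hc β ι d₁ hy M₀ hdiv hndiv hM₀
      Wd _ _ hWd hrd hSel hTam ↦
    GenusExact.PlusDescent.kFourNeg_conclusion_of_depth_one_of_hasMultiplicativeReductionAt hQ2 W hcm hr0 hρ hT hneg h4 v h2v hNv hmult K hIQ
      hodd h3 hHe hsq1 hsq2 ℓ₀ hℓ₀ hdK h2K Dt hopt hc β ι d₁ hy M₀ hdiv hndiv hM₀ Wd hWd hrd hSel hTam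

end Summit.BirchSwinnertonDyer.BirchSwinnertonDyer.Theorems

end
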